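import Literature.AnabelianGeometry.EtaleTheta.BiKummerThm44SubBiratPerfection
import Literature.AnabelianGeometry.EtaleTheta.BiKummerThm44SubModelWeak

/-!
# [EtTh] Theorem 4.4 (ii), clause (a) at the category level (`Ψ^birat`) and sub-DAG row T44-L11 (`Ψ` compatible
# with perfection) at the WEAK monoid vocabulary `treeMonoidVocabWeak` — proof-only companion

S. Mochizuki, *The étale theta function …*, Publ. RIMS **45** (2009) [MochizukiEtTh2009], §4, Thm 4.4 (ii), PDF p.94
(«`Ψ` induces a 1-compatible equivalence of categories `Ψ^birat : C₁^birat ⥲ C₂^birat`»), proof p.95 ll.7–10 («The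
existence of `Ψ^birat` follows from [FrdI], Corollary 4.10. … `Ψ` is compatible with the operation of passing to the
perfection [cf. [FrdI], Theorem 3.4, (iii)]»).

abc-iut cell, layer L2, sub-DAG `plan/L2/SUBDAG-EtTh-Thm44.md` row T44-L11 (custodian abc-iut-w5-d179; strong closers
`BiKummerThm44SubBiratPerfection.lean`).  PROOF-ONLY companion (seat abc-iut-w6-d037, gen 2): no definition, no named
fact, nothing restated.  The vocabulary-generic theorems of that file (`oneUniqueSquare_birat`,
`exists_biratEquivalence`, `cor410_birat`, `perfectionMap_isEquivalence`, `exists_pfEquivalence`; inputs "`C_i`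
Frobenioid" and T44-L03) are read at realified data typed with abc-iut-L2-t3's `treeMonoidVocabWeak` — the vocabulary
of the tempered coverings `Ÿ`, `Z_∞` where [FrdI] Def 2.4 (i)(d) fails (finding F-L2d2-1) — with T44-L03 supplied
by this seat's `Thm44Hyp.preservesFrobeniusStructure_treeVocabWeak` (`BiKummerThm44SubModelWeak.lean`):
* `Thm44Hyp.oneUniqueSquare_birat_treeVocabWeak`, `exists_biratEquivalence_treeVocabWeak`, `cor410_birat_treeVocabWeak`,
  `perfectionMap_isEquivalence_treeVocabWeak`, `exists_pfEquivalence_treeVocabWeak` ⇐ {`Remark372 D₀ / D₀'`,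
  `hBmon₁ / hBmon₂`} — settings over `treeCatVocab`;
* `Thm44Hyp.exists_biratEquivalence_mkOfConnectedTemperoid_treeVocabWeak`, `cor410_birat_mkOfConnectedTemperoid_treeVocabWeak`,
  `exists_pfEquivalence_mkOfConnectedTemperoid_treeVocabWeak` — at the genuine connected base `B^temp(Π^tp_X)⁰`
  (abc-iut-L2-t4's `mkOfConnectedTemperoid`) ⇐ {`Remark372 D₀ / D₀'`, `hBmon₁ / hBmon₂`}.
Statements name the vocabulary (`(V := treeMonoidVocabWeak)`) where they would otherwise read as their strong twins.
HONEST FRAMING: refereed pre-IUT material ([EtTh] §4 over [FrdI] §§3–4); nothing here asserts that such data exist for an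
actual curve; nothing here bears on [IUTchIII] Cor. 3.12; typed ≠ proved — here PROVED.
-/

noncomputable section

namespace Literature.AnabelianGeometry.EtaleTheta

open CategoryTheory Opposite Literature.AlgebraicGeometry.Frobenioids Literature.AnabelianGeometry.SemiGraphs

namespace BiKummerSetting

universe u₀ v₀ u v w

/-! ### Settings over the weak realified data and `treeCatVocab`: inputs `Remark372`, `hBmon` only -/

section TreeVocabWeak

variable {K : Type u₀} [Field K] {K' : Type u₀} [Field K'] {D₀ : Type u₀} [Category.{v₀} D₀]
  {X₁ : SemiGraphs.TemperedArithmeticGroup.{u₀} K} {X₂ : SemiGraphs.TemperedArithmeticGroup.{u₀} K'}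
  {D₀' : Type u₀} [Category.{v₀} D₀']
  {T₁ : RealifiedDivisorMonoids (D₀ := D₀) treeMonoidVocabWeak.{w}}
  {T₂ : RealifiedDivisorMonoids (D₀ := D₀') treeMonoidVocabWeak.{w}}
  {D₁ D₂ : Type u} [Category.{v} D₁] [Category.{v} D₂]
  {IsRational₁ IsStrictlyRational₁ : (D₁ᵒᵖ ⥤ CommMonCat.{w}) → Prop}
  {IsRational₂ IsStrictlyRational₂ : (D₂ᵒᵖ ⥤ CommMonCat.{w}) → Prop}
  {S₁ : BiKummerSetting X₁ T₁ D₁ (treeCatVocab D₁ IsRational₁ IsStrictlyRational₁)}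
  {S₂ : BiKummerSetting X₂ T₂ D₂ (treeCatVocab D₂ IsRational₂ IsStrictlyRational₂)}

/-- **Thm 4.4 (ii), clause (a), categorical, at the WEAK vocabulary** ⇐ {Rmk 3.7.2, `hBmon`}: `Ψ^birat := Birat.mapOfEquiv`
is an equivalence, `1`-commutes with `C_i → C_i^birat`, and is `1`-unique ([FrdI] Cor 4.10) — "`C_i` Frobenioid" by
`isFrobenioid_treeCatVocab_of_isMonoidOn`, T44-L03 by `preservesFrobeniusStructure_treeVocabWeak`.
[cite: MochizukiEtTh2009, Thm 4.4 (ii) p.94] -/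
theorem Thm44Hyp.oneUniqueSquare_birat_treeVocabWeak (h : Thm44Hyp S₁ S₂)
    (h372 : TemperedFrobenioid.Remark372 D₀) (h372' : TemperedFrobenioid.Remark372 D₀')
    (hBmon₁ : IsMonoidOn S₁.tf.ratFnFunctor) (hBmon₂ : IsMonoidOn S₂.tf.ratFnFunctor) :
    PreFrobenioidData.OneUniqueSquare h.Ψ.functor
      (PreFrobenioid.toBirat S₁.F (S₁.tf.isFrobenioid_treeCatVocab_of_isMonoidOn hBmon₁)
        (PreFrobenioid.hasBiratSquares_of_isFrobenioid (S₁.tf.isFrobenioid_treeCatVocab_of_isMonoidOn hBmon₁)))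
      (PreFrobenioid.toBirat S₂.F (S₂.tf.isFrobenioid_treeCatVocab_of_isMonoidOn hBmon₂)
        (PreFrobenioid.hasBiratSquares_of_isFrobenioid (S₂.tf.isFrobenioid_treeCatVocab_of_isMonoidOn hBmon₂)))
      (PreFrobenioid.Birat.mapOfEquiv (S₁.tf.isFrobenioid_treeCatVocab_of_isMonoidOn hBmon₁)
        (PreFrobenioid.hasBiratSquares_of_isFrobenioid (S₁.tf.isFrobenioid_treeCatVocab_of_isMonoidOn hBmon₁))
        (S₂.tf.isFrobenioid_treeCatVocab_of_isMonoidOn hBmon₂)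
        (PreFrobenioid.hasBiratSquares_of_isFrobenioid (S₂.tf.isFrobenioid_treeCatVocab_of_isMonoidOn hBmon₂))
        h.Ψ (fun _ _ _ hf => h.isCoAngularPreStep_map
          (h.preservesFrobeniusStructure_treeVocabWeak h372 h372' hBmon₁ hBmon₂) hf)) :=
  h.oneUniqueSquare_birat _ _ (h.preservesFrobeniusStructure_treeVocabWeak h372 h372' hBmon₁ hBmon₂)

/-- **Thm 4.4 (ii), clause (a), print's wording, at the WEAK vocabulary** ⇐ {Rmk 3.7.2, `hBmon`}: an equivalence
`Ψ^birat : C₁^birat ⥲ C₂^birat` with `(C₁ → C₁^birat) ⋙ Ψ^birat ≅ Ψ ⋙ (C₂ → C₂^birat)`.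
[cite: MochizukiEtTh2009, Thm 4.4 (ii) p.94] -/
theorem Thm44Hyp.exists_biratEquivalence_treeVocabWeak (h : Thm44Hyp S₁ S₂)
    (h372 : TemperedFrobenioid.Remark372 D₀) (h372' : TemperedFrobenioid.Remark372 D₀')
    (hBmon₁ : IsMonoidOn S₁.tf.ratFnFunctor) (hBmon₂ : IsMonoidOn S₂.tf.ratFnFunctor) :
    ∃ Ψbirat : PreFrobenioid.Birat (BiKummerSetting.F (V := treeMonoidVocabWeak.{w}) S₁)
          (S₁.tf.isFrobenioid_treeCatVocab_of_isMonoidOn hBmon₁)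
          (PreFrobenioid.hasBiratSquares_of_isFrobenioid (S₁.tf.isFrobenioid_treeCatVocab_of_isMonoidOn hBmon₁)) ≌
        PreFrobenioid.Birat S₂.F (S₂.tf.isFrobenioid_treeCatVocab_of_isMonoidOn hBmon₂)
          (PreFrobenioid.hasBiratSquares_of_isFrobenioid (S₂.tf.isFrobenioid_treeCatVocab_of_isMonoidOn hBmon₂)),
      Nonempty (PreFrobenioid.toBirat S₁.F _
          (PreFrobenioid.hasBiratSquares_of_isFrobenioid (S₁.tf.isFrobenioid_treeCatVocab_of_isMonoidOn hBmon₁)) ⋙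
          Ψbirat.functor ≅
        h.Ψ.functor ⋙ PreFrobenioid.toBirat S₂.F _
          (PreFrobenioid.hasBiratSquares_of_isFrobenioid (S₂.tf.isFrobenioid_treeCatVocab_of_isMonoidOn hBmon₂))) :=
  h.exists_biratEquivalence _ _ (h.preservesFrobeniusStructure_treeVocabWeak h372 h372' hBmon₁ hBmon₂)

/-- **[FrdI] Cor 4.10 AS TYPED at `(C₁, C₂, Ψ)`, WEAK vocabulary** ⇐ {Rmk 3.7.2, `hBmon`}.
[cite: MochizukiEtTh2009, Thm 4.4 (ii) p.95] -/
theorem Thm44Hyp.cor410_birat_treeVocabWeak (h : Thm44Hyp S₁ S₂)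
    (h372 : TemperedFrobenioid.Remark372 D₀) (h372' : TemperedFrobenioid.Remark372 D₀')
    (hBmon₁ : IsMonoidOn S₁.tf.ratFnFunctor) (hBmon₂ : IsMonoidOn S₂.tf.ratFnFunctor) :
    PreFrobenioidData.Cor410
      (PreFrobenioidData.ofFunctor (BiKummerSetting.tf (V := treeMonoidVocabWeak.{w}) S₁).divisorMonoid S₁.F)
      (PreFrobenioidData.ofFunctor S₂.tf.divisorMonoid S₂.F) h.Ψ
      (PreFrobenioid.biratData (S₁.tf.isFrobenioid_treeCatVocab_of_isMonoidOn hBmon₁)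
        (PreFrobenioid.hasBiratSquares_of_isFrobenioid (S₁.tf.isFrobenioid_treeCatVocab_of_isMonoidOn hBmon₁)))
      (PreFrobenioid.biratData (S₂.tf.isFrobenioid_treeCatVocab_of_isMonoidOn hBmon₂)
        (PreFrobenioid.hasBiratSquares_of_isFrobenioid (S₂.tf.isFrobenioid_treeCatVocab_of_isMonoidOn hBmon₂))) :=
  h.cor410_birat _ _ (h.preservesFrobeniusStructure_treeVocabWeak h372 h372' hBmon₁ hBmon₂)

/-- **T44-L11 at the WEAK vocabulary** ⇐ {Rmk 3.7.2, `hBmon`}: `Ψ^pf := Perfection.map` is an equivalence.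
[cite: MochizukiEtTh2009, Thm 4.4 (ii) p.95] -/
theorem Thm44Hyp.perfectionMap_isEquivalence_treeVocabWeak (h : Thm44Hyp S₁ S₂)
    (h372 : TemperedFrobenioid.Remark372 D₀) (h372' : TemperedFrobenioid.Remark372 D₀')
    (hBmon₁ : IsMonoidOn S₁.tf.ratFnFunctor) (hBmon₂ : IsMonoidOn S₂.tf.ratFnFunctor) :
    (PreFrobenioid.Perfection.map (hF₁ := S₁.tf.isFrobenioid_treeCatVocab_of_isMonoidOn hBmon₁)
      (hF₂ := S₂.tf.isFrobenioid_treeCatVocab_of_isMonoidOn hBmon₂)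
      (h.isFrobeniusCompatible (h.preservesFrobeniusStructure_treeVocabWeak h372 h372' hBmon₁ hBmon₂))).IsEquivalence :=
  h.perfectionMap_isEquivalence _ _ (h.preservesFrobeniusStructure_treeVocabWeak h372 h372' hBmon₁ hBmon₂)

/-- **T44-L11 at the WEAK vocabulary, print's wording** ⇐ {Rmk 3.7.2, `hBmon`}: an equivalence `Ψ^pf : C₁^pf ⥲ C₂^pf`
with `(C₁ → C₁^pf) ⋙ Ψ^pf ≅ Ψ ⋙ (C₂ → C₂^pf)`. [cite: MochizukiEtTh2009, Thm 4.4 (ii) p.95] -/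
theorem Thm44Hyp.exists_pfEquivalence_treeVocabWeak (h : Thm44Hyp S₁ S₂)
    (h372 : TemperedFrobenioid.Remark372 D₀) (h372' : TemperedFrobenioid.Remark372 D₀')
    (hBmon₁ : IsMonoidOn S₁.tf.ratFnFunctor) (hBmon₂ : IsMonoidOn S₂.tf.ratFnFunctor) :
    ∃ Ψpf : PreFrobenioid.Perfection (F := BiKummerSetting.F (V := treeMonoidVocabWeak.{w}) S₁)
          (S₁.tf.isFrobenioid_treeCatVocab_of_isMonoidOn hBmon₁) ≌
        PreFrobenioid.Perfection (S₂.tf.isFrobenioid_treeCatVocab_of_isMonoidOn hBmon₂),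
      Nonempty (PreFrobenioid.Perfection.toPf (S₁.tf.isFrobenioid_treeCatVocab_of_isMonoidOn hBmon₁) ⋙
          Ψpf.functor ≅
        h.Ψ.functor ⋙ PreFrobenioid.Perfection.toPf (S₂.tf.isFrobenioid_treeCatVocab_of_isMonoidOn hBmon₂)) :=
  h.exists_pfEquivalence _ _ (h.preservesFrobeniusStructure_treeVocabWeak h372 h372' hBmon₁ hBmon₂)

end TreeVocabWeak

/-! ### At the genuine connected base `B^temp(Π^tp_X)⁰` (`mkOfConnectedTemperoid`), weak vocabulary -/

section Connected

variable {K : Type u₀} [Field K] {K' : Type u₀} [Field K'] {X₁ : SemiGraphs.TemperedArithmeticGroup.{u₀} K}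
  {X₂ : SemiGraphs.TemperedArithmeticGroup.{u₀} K'} {D₀ : Type u₀} [Category.{v₀} D₀] {D₀' : Type u₀}
  [Category.{v₀} D₀'] {T₁ : RealifiedDivisorMonoids (D₀ := D₀) treeMonoidVocabWeak.{w}}
  {T₂ : RealifiedDivisorMonoids (D₀ := D₀') treeMonoidVocabWeak.{w}}
  {IsRational₁ IsStrictlyRational₁ : ((ConnectedPart (BTemp X₁.Pi))ᵒᵖ ⥤ CommMonCat.{w}) → Prop}
  {IsRational₂ IsStrictlyRational₂ : ((ConnectedPart (BTemp X₂.Pi))ᵒᵖ ⥤ CommMonCat.{w}) → Prop}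
  {tf₁ : TemperedFrobenioid T₁ (ConnectedPart (BTemp X₁.Pi))
    (treeCatVocab (ConnectedPart (BTemp X₁.Pi)) IsRational₁ IsStrictlyRational₁)}
  {hZ₁ : tf₁.monoidType = MonoidType.Z} {hP₁ : ∀ A : (ConnectedPart (BTemp X₁.Pi))ᵒᵖ, IsPerfect (tf₁.Φ.carrier A)}
  {NH₁ : Subgroup (Field.absoluteGaloisGroup K) → tf₁.category → ℕ+ → Prop} {A₁ : tf₁.category}
  {hA₁ : PreFrobenioid.IsFrobeniusTrivial tf₁.toElem A₁} {hA₁' : SemiGraphs.IsGaloisObj A₁.base.obj}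
  {tf₂ : TemperedFrobenioid T₂ (ConnectedPart (BTemp X₂.Pi))
    (treeCatVocab (ConnectedPart (BTemp X₂.Pi)) IsRational₂ IsStrictlyRational₂)}
  {hZ₂ : tf₂.monoidType = MonoidType.Z} {hP₂ : ∀ B : (ConnectedPart (BTemp X₂.Pi))ᵒᵖ, IsPerfect (tf₂.Φ.carrier B)}
  {NH₂ : Subgroup (Field.absoluteGaloisGroup K') → tf₂.category → ℕ+ → Prop} {A₂ : tf₂.category}
  {hA₂ : PreFrobenioid.IsFrobeniusTrivial tf₂.toElem A₂} {hA₂' : SemiGraphs.IsGaloisObj A₂.base.obj}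

/-- **Thm 4.4 (ii), clause (a), print's wording, at the genuine connected base, WEAK vocabulary** ⇐ {Rmk 3.7.2, `hBmon`}.
[cite: MochizukiEtTh2009, Thm 4.4 (ii) p.94] -/
theorem Thm44Hyp.exists_biratEquivalence_mkOfConnectedTemperoid_treeVocabWeak
    (h : Thm44Hyp (mkOfConnectedTemperoid X₁ tf₁ hZ₁ hP₁ NH₁ A₁ hA₁ hA₁')
      (mkOfConnectedTemperoid X₂ tf₂ hZ₂ hP₂ NH₂ A₂ hA₂ hA₂'))
    (h372 : TemperedFrobenioid.Remark372 D₀) (h372' : TemperedFrobenioid.Remark372 D₀')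
    (hBmon₁ : IsMonoidOn tf₁.ratFnFunctor) (hBmon₂ : IsMonoidOn tf₂.ratFnFunctor) :
    ∃ Ψbirat : PreFrobenioid.Birat (TemperedFrobenioid.toElem (V := treeMonoidVocabWeak.{w}) tf₁)
          (tf₁.isFrobenioid_treeCatVocab_of_isMonoidOn hBmon₁)
          (PreFrobenioid.hasBiratSquares_of_isFrobenioid (tf₁.isFrobenioid_treeCatVocab_of_isMonoidOn hBmon₁)) ≌
        PreFrobenioid.Birat tf₂.toElem (tf₂.isFrobenioid_treeCatVocab_of_isMonoidOn hBmon₂)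
          (PreFrobenioid.hasBiratSquares_of_isFrobenioid (tf₂.isFrobenioid_treeCatVocab_of_isMonoidOn hBmon₂)),
      Nonempty (PreFrobenioid.toBirat tf₁.toElem _
          (PreFrobenioid.hasBiratSquares_of_isFrobenioid (tf₁.isFrobenioid_treeCatVocab_of_isMonoidOn hBmon₁)) ⋙
          Ψbirat.functor ≅
        h.Ψ.functor ⋙ PreFrobenioid.toBirat tf₂.toElem _
          (PreFrobenioid.hasBiratSquares_of_isFrobenioid (tf₂.isFrobenioid_treeCatVocab_of_isMonoidOn hBmon₂))) :=
  h.exists_biratEquivalence_treeVocabWeak h372 h372' hBmon₁ hBmon₂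

/-- **[FrdI] Cor 4.10 AS TYPED at `(C₁, C₂, Ψ)`, genuine connected base, WEAK vocabulary** ⇐ {Rmk 3.7.2, `hBmon`}.
[cite: MochizukiEtTh2009, Thm 4.4 (ii) p.95] -/
theorem Thm44Hyp.cor410_birat_mkOfConnectedTemperoid_treeVocabWeak
    (h : Thm44Hyp (mkOfConnectedTemperoid X₁ tf₁ hZ₁ hP₁ NH₁ A₁ hA₁ hA₁')
      (mkOfConnectedTemperoid X₂ tf₂ hZ₂ hP₂ NH₂ A₂ hA₂ hA₂'))
    (h372 : TemperedFrobenioid.Remark372 D₀) (h372' : TemperedFrobenioid.Remark372 D₀')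
    (hBmon₁ : IsMonoidOn tf₁.ratFnFunctor) (hBmon₂ : IsMonoidOn tf₂.ratFnFunctor) :
    PreFrobenioidData.Cor410
      (PreFrobenioidData.ofFunctor (TemperedFrobenioid.divisorMonoid (V := treeMonoidVocabWeak.{w}) tf₁) tf₁.toElem)
      (PreFrobenioidData.ofFunctor tf₂.divisorMonoid tf₂.toElem) h.Ψ
      (PreFrobenioid.biratData (tf₁.isFrobenioid_treeCatVocab_of_isMonoidOn hBmon₁)
        (PreFrobenioid.hasBiratSquares_of_isFrobenioid (tf₁.isFrobenioid_treeCatVocab_of_isMonoidOn hBmon₁)))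
      (PreFrobenioid.biratData (tf₂.isFrobenioid_treeCatVocab_of_isMonoidOn hBmon₂)
        (PreFrobenioid.hasBiratSquares_of_isFrobenioid (tf₂.isFrobenioid_treeCatVocab_of_isMonoidOn hBmon₂))) :=
  h.cor410_birat_treeVocabWeak h372 h372' hBmon₁ hBmon₂

/-- **T44-L11, print's wording, at the genuine connected base, WEAK vocabulary** ⇐ {Rmk 3.7.2, `hBmon`}: an equivalence
`Ψ^pf : C₁^pf ⥲ C₂^pf` with `(C₁ → C₁^pf) ⋙ Ψ^pf ≅ Ψ ⋙ (C₂ → C₂^pf)`. [cite: MochizukiEtTh2009, Thm 4.4 (ii) p.95] -/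
theorem Thm44Hyp.exists_pfEquivalence_mkOfConnectedTemperoid_treeVocabWeak
    (h : Thm44Hyp (mkOfConnectedTemperoid X₁ tf₁ hZ₁ hP₁ NH₁ A₁ hA₁ hA₁')
      (mkOfConnectedTemperoid X₂ tf₂ hZ₂ hP₂ NH₂ A₂ hA₂ hA₂'))
    (h372 : TemperedFrobenioid.Remark372 D₀) (h372' : TemperedFrobenioid.Remark372 D₀')
    (hBmon₁ : IsMonoidOn tf₁.ratFnFunctor) (hBmon₂ : IsMonoidOn tf₂.ratFnFunctor) :
    ∃ Ψpf : PreFrobenioid.Perfection (F := TemperedFrobenioid.toElem (V := treeMonoidVocabWeak.{w}) tf₁)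
          (tf₁.isFrobenioid_treeCatVocab_of_isMonoidOn hBmon₁) ≌
        PreFrobenioid.Perfection (F := tf₂.toElem) (tf₂.isFrobenioid_treeCatVocab_of_isMonoidOn hBmon₂),
      Nonempty (PreFrobenioid.Perfection.toPf (tf₁.isFrobenioid_treeCatVocab_of_isMonoidOn hBmon₁) ⋙
          Ψpf.functor ≅
        h.Ψ.functor ⋙ PreFrobenioid.Perfection.toPf (tf₂.isFrobenioid_treeCatVocab_of_isMonoidOn hBmon₂)) :=
  h.exists_pfEquivalence_treeVocabWeak h372 h372' hBmon₁ hBmon₂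

end Connected

end BiKummerSetting

end Literature.AnabelianGeometry.EtaleTheta

end
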